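import Mathlib.NumberTheory.ArithmeticFunction.Misc
import Mathlib.Data.Nat.Factorization.Basic
import Mathlib.Data.Int.GCD
import Mathlib.Analysis.SpecialFunctions.Pow.Real
import Mathlib.Algebra.BigOperators.Field
import HarnessLib

/-!
# Bombieri–Friedlander–Iwaniec 1986, Lemma 6: the two lattice-point counts

Topic `Literature/NumberTheory/Sieve`.  Elementary counting lemmas used in the proof of Lemma 6
(§8, (8.4), p. 227) of E. Bombieri, J. B. Friedlander, H. Iwaniec, *Primes in arithmetic
progressions to large moduli*, Acta Math. 156 (1986), 203–251, from their Lemma 1 (the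
Deshouillers–Iwaniec bound for sums of Kloosterman sums).  On p. 227 two counts are used without
comment:

* the diagonal `♯{q₁, q₂ ≤ Q, h₁, h₂ ≤ H : h₁q₂ = h₂q₁} ≪ HQ (log 2HQ)^4` ("The terms on the
  diagonal (n = 0) … contribute trivially `≪ CDHKQ (log 2HQ)⁴`"), and
* `♯{q₁, q₂, h₁, h₂, h₃, h₄ : (h₁ − h₃)q₂ = (h₂ − h₄)q₁} ≪ (HQ)^ε (H²Q² + H³Q)` (the bound for
  `‖B‖²`).

Both follow from the bound, for FIXED `q₁, q₂ ≥ 1` and an integer `l`, of the number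
`ν(l; q₁, q₂)` of pairs `1 ≤ h₁, h₂ ≤ H` with `h₁q₂ − h₂q₁ = l`:
`ν(l; q₁, q₂) ≤ H·(q₁,q₂)/max(q₁,q₂) + 1`, and `ν(0; q₁, q₂) ≤ H·(q₁,q₂)/max(q₁,q₂)` (no `+1`:
`h = 0` is excluded), together with `∑_{q₂ ≤ q₁} (q₁, q₂) ≤ q₁ τ(q₁)`, whence
`∑_{q₁,q₂ ≤ Q} (q₁,q₂)/max(q₁,q₂) ≤ 2 ∑_{q ≤ Q} τ(q)`.  Everything here is PROVED (no named facts);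
the file imports only Mathlib.

## Contents

* `BFI.gcd_le_sum_divisors_filter_dvd`, `BFI.sum_Icc_gcd_le` (`∑_{q₂≤q₁} (q₁,q₂) ≤ q₁ τ(q₁)`),
  `BFI.sum_sum_gcd_div_max_le` (`∑_{q₁,q₂≤Q} (q₁,q₂)/max ≤ 2∑_{q≤Q} τ(q)`).
* `BFI.linePairs q₁ q₂ H l` — the solution set of `h₁q₂ − h₂q₁ = l` in `[1,H]²`;
  `BFI.card_linePairs_le_left` (`≤ H(q₁,q₂)/q₁ + 1`), `BFI.card_linePairs_le`
  (`≤ H(q₁,q₂)/max(q₁,q₂) + 1`).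
* `BFI.diagPairs q₁ q₂ H` — the case `l = 0`; `BFI.card_diagPairs_le_left` (`≤ H(q₁,q₂)/q₁`),
  `BFI.card_diagPairs_le` (`≤ H(q₁,q₂)/max(q₁,q₂)`), `BFI.sum_card_diagPairs_le`
  (`∑_{q₁,q₂≤Q} ♯diag ≤ 2H ∑_{q≤Q} τ(q)`), `BFI.sum_card_linePairs_bound_le`
  (`∑_{q₁,q₂≤Q} (H(q₁,q₂)/max + 1) ≤ Q² + 2H∑_{q≤Q}τ(q)`).

## References

* E. Bombieri, J. B. Friedlander, H. Iwaniec, Acta Math. 156 (1986), 203–251, §8, proof of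
  Lemma 6, p. 227. [BombieriFriedlanderIwaniecActa1986]
-/

open Finset

namespace Literature.NumberTheory.Sieve

namespace BFI

/-! ### Sums of greatest common divisors -/

/-- `(q, q₂)` is one of the common divisors, so it is at most their sum:
`(q, q₂) ≤ ∑_{g ∣ q, g ∣ q₂} g` for `q ≥ 1`. [folklore] -/
theorem gcd_le_sum_divisors_filter_dvd {q : ℕ} (hq : q ≠ 0) (q₂ : ℕ) :
    Nat.gcd q q₂ ≤ ∑ g ∈ q.divisors.filter (fun g => g ∣ q₂), g := by
  have hmem : Nat.gcd q q₂ ∈ q.divisors.filter (fun g => g ∣ q₂) := by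
    rw [Finset.mem_filter, Nat.mem_divisors]
    exact ⟨⟨Nat.gcd_dvd_left q q₂, hq⟩, Nat.gcd_dvd_right q q₂⟩
  exact Finset.single_le_sum (f := fun g => g) (fun _ _ => Nat.zero_le _) hmem

/-- **`∑_{1 ≤ q₂ ≤ q} (q, q₂) ≤ q τ(q)`**: group by the common divisor `g ∣ q`; the `q₂ ≤ q`
divisible by `g` number `q/g`. [folklore] -/
theorem sum_Icc_gcd_le (q : ℕ) : ∑ q₂ ∈ Icc 1 q, Nat.gcd q q₂ ≤ q * #q.divisors := by
  rcases eq_or_ne q 0 with rfl | hq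
  · simp
  calc ∑ q₂ ∈ Icc 1 q, Nat.gcd q q₂
      ≤ ∑ q₂ ∈ Icc 1 q, ∑ g ∈ q.divisors.filter (fun g => g ∣ q₂), g :=
        Finset.sum_le_sum fun q₂ _ => gcd_le_sum_divisors_filter_dvd hq q₂
    _ = ∑ q₂ ∈ Icc 1 q, ∑ g ∈ q.divisors, if g ∣ q₂ then g else 0 := by
        refine Finset.sum_congr rfl fun q₂ _ => ?_
        rw [Finset.sum_filter]
    _ = ∑ g ∈ q.divisors, ∑ q₂ ∈ Icc 1 q, if g ∣ q₂ then g else 0 := Finset.sum_comm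
    _ = ∑ g ∈ q.divisors, g * #((Icc 1 q).filter (fun q₂ => g ∣ q₂)) := by
        refine Finset.sum_congr rfl fun g _ => ?_
        rw [← Finset.sum_filter, Finset.sum_const, smul_eq_mul, mul_comm]
    _ = ∑ g ∈ q.divisors, g * (q / g) := by
        refine Finset.sum_congr rfl fun g _ => ?_
        congr 1
        have h := Nat.Ioc_filter_dvd_card_eq_div q g
        rwa [show Ioc 0 q = Icc 1 q from rfl] at h
    _ ≤ ∑ g ∈ q.divisors, q := Finset.sum_le_sum fun g _ => Nat.mul_div_le q g
    _ = q * #q.divisors := by rw [Finset.sum_const, smul_eq_mul, mul_comm]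

/-- **`∑_{1 ≤ q₁, q₂ ≤ Q} (q₁,q₂)/max(q₁,q₂) ≤ 2 ∑_{q ≤ Q} τ(q)`** (split according to
`q₂ ≤ q₁` or `q₁ ≤ q₂` and use `BFI.sum_Icc_gcd_le`). [folklore] -/
theorem sum_sum_gcd_div_max_le (Q : ℕ) :
    ∑ q₁ ∈ Icc 1 Q, ∑ q₂ ∈ Icc 1 Q, ((Nat.gcd q₁ q₂ : ℕ) : ℝ) / ((max q₁ q₂ : ℕ) : ℝ) ≤
      2 * ∑ q ∈ Icc 1 Q, ((#q.divisors : ℕ) : ℝ) := by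
  -- one half: `∑_{q₁} ∑_{q₂ ≤ q₁} (q₁,q₂)/q₁ ≤ ∑ τ`
  have half : ∀ Q : ℕ, ∑ q₁ ∈ Icc 1 Q, ∑ q₂ ∈ Icc 1 Q,
      (if q₂ ≤ q₁ then ((Nat.gcd q₁ q₂ : ℕ) : ℝ) / (q₁ : ℝ) else 0) ≤
        ∑ q ∈ Icc 1 Q, ((#q.divisors : ℕ) : ℝ) := by
    intro Q
    refine Finset.sum_le_sum fun q₁ hq₁ => ?_
    have hq₁1 : 1 ≤ q₁ := (Finset.mem_Icc.1 hq₁).1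
    have hq₁0 : (0 : ℝ) < q₁ := by exact_mod_cast hq₁1
    rw [← Finset.sum_filter]
    have hsub : (Icc 1 Q).filter (fun q₂ => q₂ ≤ q₁) ⊆ Icc 1 q₁ := by
      intro q₂ hq₂
      rw [Finset.mem_filter, Finset.mem_Icc] at hq₂
      exact Finset.mem_Icc.2 ⟨hq₂.1.1, hq₂.2⟩
    calc ∑ q₂ ∈ (Icc 1 Q).filter (fun q₂ => q₂ ≤ q₁), ((Nat.gcd q₁ q₂ : ℕ) : ℝ) / (q₁ : ℝ)
        ≤ ∑ q₂ ∈ Icc 1 q₁, ((Nat.gcd q₁ q₂ : ℕ) : ℝ) / (q₁ : ℝ) :=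
          Finset.sum_le_sum_of_subset_of_nonneg hsub fun _ _ _ => by positivity
      _ = (∑ q₂ ∈ Icc 1 q₁, (Nat.gcd q₁ q₂ : ℕ) : ℕ) / (q₁ : ℝ) := by
          rw [Nat.cast_sum, Finset.sum_div]
      _ ≤ ((q₁ * #q₁.divisors : ℕ) : ℝ) / (q₁ : ℝ) := by
          gcongr
          exact_mod_cast sum_Icc_gcd_le q₁
      _ = ((#q₁.divisors : ℕ) : ℝ) := by
          rw [Nat.cast_mul]; field_simp
  -- pointwise split
  have hpt : ∀ q₁ ∈ Icc 1 Q, ∀ q₂ ∈ Icc 1 Q,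
      ((Nat.gcd q₁ q₂ : ℕ) : ℝ) / ((max q₁ q₂ : ℕ) : ℝ) ≤
        (if q₂ ≤ q₁ then ((Nat.gcd q₁ q₂ : ℕ) : ℝ) / (q₁ : ℝ) else 0) +
          (if q₁ ≤ q₂ then ((Nat.gcd q₂ q₁ : ℕ) : ℝ) / (q₂ : ℝ) else 0) := by
    intro q₁ _ q₂ _
    rcases le_total q₂ q₁ with h | h
    · rw [max_eq_left h, if_pos h]
      have : 0 ≤ (if q₁ ≤ q₂ then ((Nat.gcd q₂ q₁ : ℕ) : ℝ) / (q₂ : ℝ) else 0) := by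
        split_ifs <;> positivity
      linarith
    · rw [max_eq_right h, if_pos h, Nat.gcd_comm q₂ q₁]
      have : 0 ≤ (if q₂ ≤ q₁ then ((Nat.gcd q₁ q₂ : ℕ) : ℝ) / (q₁ : ℝ) else 0) := by
        split_ifs <;> positivity
      linarith
  calc ∑ q₁ ∈ Icc 1 Q, ∑ q₂ ∈ Icc 1 Q, ((Nat.gcd q₁ q₂ : ℕ) : ℝ) / ((max q₁ q₂ : ℕ) : ℝ)
      ≤ ∑ q₁ ∈ Icc 1 Q, ∑ q₂ ∈ Icc 1 Q,
          ((if q₂ ≤ q₁ then ((Nat.gcd q₁ q₂ : ℕ) : ℝ) / (q₁ : ℝ) else 0) +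
            (if q₁ ≤ q₂ then ((Nat.gcd q₂ q₁ : ℕ) : ℝ) / (q₂ : ℝ) else 0)) :=
        Finset.sum_le_sum fun q₁ hq₁ => Finset.sum_le_sum fun q₂ hq₂ => hpt q₁ hq₁ q₂ hq₂
    _ = (∑ q₁ ∈ Icc 1 Q, ∑ q₂ ∈ Icc 1 Q,
          (if q₂ ≤ q₁ then ((Nat.gcd q₁ q₂ : ℕ) : ℝ) / (q₁ : ℝ) else 0)) +
        ∑ q₁ ∈ Icc 1 Q, ∑ q₂ ∈ Icc 1 Q,
          (if q₁ ≤ q₂ then ((Nat.gcd q₂ q₁ : ℕ) : ℝ) / (q₂ : ℝ) else 0) := by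
        simp only [Finset.sum_add_distrib]
    _ = (∑ q₁ ∈ Icc 1 Q, ∑ q₂ ∈ Icc 1 Q,
          (if q₂ ≤ q₁ then ((Nat.gcd q₁ q₂ : ℕ) : ℝ) / (q₁ : ℝ) else 0)) +
        ∑ q₂ ∈ Icc 1 Q, ∑ q₁ ∈ Icc 1 Q,
          (if q₁ ≤ q₂ then ((Nat.gcd q₂ q₁ : ℕ) : ℝ) / (q₂ : ℝ) else 0) := by
        congr 1
        exact Finset.sum_comm
    _ ≤ ∑ q ∈ Icc 1 Q, ((#q.divisors : ℕ) : ℝ) + ∑ q ∈ Icc 1 Q, ((#q.divisors : ℕ) : ℝ) :=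
        add_le_add (half Q) (half Q)
    _ = 2 * ∑ q ∈ Icc 1 Q, ((#q.divisors : ℕ) : ℝ) := by ring

/-! ### Pairs on a line: `h₁ q₂ − h₂ q₁ = l` -/

/-- The pairs `1 ≤ h₁, h₂ ≤ H` with `h₁ q₂ − h₂ q₁ = l` (BFI p. 227: the number of solutions of
`h₁q₂ − h₂q₁ = l`). [cite: BombieriFriedlanderIwaniecActa1986, §8 p. 227] -/
def linePairs (q₁ q₂ H : ℕ) (l : ℤ) : Finset (ℕ × ℕ) :=
  (Icc 1 H ×ˢ Icc 1 H).filter (fun p => (p.1 : ℤ) * q₂ - (p.2 : ℤ) * q₁ = l)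

/-- Membership in `linePairs`. [folklore] -/
theorem mem_linePairs {q₁ q₂ H : ℕ} {l : ℤ} {p : ℕ × ℕ} :
    p ∈ linePairs q₁ q₂ H l ↔
      (1 ≤ p.1 ∧ p.1 ≤ H) ∧ (1 ≤ p.2 ∧ p.2 ≤ H) ∧ (p.1 : ℤ) * q₂ - (p.2 : ℤ) * q₁ = l := by
  simp only [linePairs, Finset.mem_filter, Finset.mem_product, Finset.mem_Icc, and_assoc]

/-- Two solutions of `h₁q₂ − h₂q₁ = l` have `h₁ ≡ h₁' (mod q₁/(q₁,q₂))`. [folklore] -/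
theorem modEq_of_mem_linePairs {q₁ q₂ H : ℕ} (hq₁ : q₁ ≠ 0) {l : ℤ} {p p' : ℕ × ℕ}
    (hp : p ∈ linePairs q₁ q₂ H l) (hp' : p' ∈ linePairs q₁ q₂ H l) :
    p.1 ≡ p'.1 [MOD q₁ / Nat.gcd q₁ q₂] := by
  rw [mem_linePairs] at hp hp'
  set g := Nat.gcd q₁ q₂ with hg
  have hg0 : 0 < g := Nat.gcd_pos_of_pos_left _ (Nat.pos_of_ne_zero hq₁)
  set a := q₁ / g with ha
  set b := q₂ / g with hb
  have hqa : q₁ = a * g := (Nat.div_mul_cancel (Nat.gcd_dvd_left q₁ q₂)).symm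
  have hqb : q₂ = b * g := (Nat.div_mul_cancel (Nat.gcd_dvd_right q₁ q₂)).symm
  have hcop : Nat.Coprime a b := Nat.coprime_div_gcd_div_gcd hg0
  -- `(p'.1 - p.1) q₂ = (p'.2 - p.2) q₁`
  have h1 : ((p'.1 : ℤ) - p.1) * q₂ = ((p'.2 : ℤ) - p.2) * q₁ := by linear_combination hp'.2.2 - hp.2.2
  have h2 : ((p'.1 : ℤ) - p.1) * b = ((p'.2 : ℤ) - p.2) * a := by
    have hg0' : (g : ℤ) ≠ 0 := by exact_mod_cast hg0.ne'
    have : ((p'.1 : ℤ) - p.1) * b * g = ((p'.2 : ℤ) - p.2) * a * g := by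
      rw [mul_assoc, mul_assoc, ← Nat.cast_mul, ← Nat.cast_mul, ← hqa, ← hqb]; exact h1
    exact mul_right_cancel₀ hg0' this
  have hdvd : (a : ℤ) ∣ ((p'.1 : ℤ) - p.1) * b := ⟨(p'.2 : ℤ) - p.2, by rw [h2]; ring⟩
  have hcopZ : IsCoprime (a : ℤ) (b : ℤ) := Nat.isCoprime_iff_coprime.2 hcop
  have hdvd' : (a : ℤ) ∣ (p'.1 : ℤ) - p.1 := hcopZ.dvd_of_dvd_mul_right hdvd
  exact (Nat.modEq_iff_dvd.2 hdvd')

/-- **`ν(l; q₁, q₂) ≤ H (q₁,q₂)/q₁ + 1`**: the first coordinates of the solutions lie in one residue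
class modulo `q₁/(q₁,q₂)` and determine the second coordinates. [folklore] -/
theorem card_linePairs_le_left {q₁ q₂ H : ℕ} (hq₁ : q₁ ≠ 0) (l : ℤ) :
    (#(linePairs q₁ q₂ H l) : ℝ) ≤ (H : ℝ) * (Nat.gcd q₁ q₂ : ℕ) / q₁ + 1 := by
  set g := Nat.gcd q₁ q₂ with hg
  have hg0 : 0 < g := Nat.gcd_pos_of_pos_left _ (Nat.pos_of_ne_zero hq₁)
  set a := q₁ / g with ha
  have hqa : q₁ = a * g := (Nat.div_mul_cancel (Nat.gcd_dvd_left q₁ q₂)).symm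
  have ha0 : 0 < a := by
    rcases Nat.eq_zero_or_pos a with h | h
    · rw [h, zero_mul] at hqa; exact absurd hqa hq₁
    · exact h
  -- injection `p ↦ p.1 / a` into `range (H / a + 1)`
  have hcard : #(linePairs q₁ q₂ H l) ≤ #(Finset.range (H / a + 1)) := by
    refine Finset.card_le_card_of_injOn (fun p => p.1 / a) ?_ ?_
    · intro p hp
      rw [Finset.mem_coe, mem_linePairs] at hp
      rw [Finset.mem_coe, Finset.mem_range, Nat.lt_add_one_iff]
      exact Nat.div_le_div_right hp.1.2
    · intro p hp p' hp' hdiv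
      rw [Finset.mem_coe] at hp hp'
      have hmod := modEq_of_mem_linePairs hq₁ hp hp'
      rw [mem_linePairs] at hp hp'
      have h1 : p.1 = p'.1 := by
        have e1 := Nat.div_add_mod p.1 a
        have e2 := Nat.div_add_mod p'.1 a
        have hdiv' : p.1 / a = p'.1 / a := hdiv
        rw [← hg, ← ha] at hmod
        unfold Nat.ModEq at hmod
        calc p.1 = a * (p.1 / a) + p.1 % a := e1.symm
          _ = a * (p'.1 / a) + p'.1 % a := by rw [hdiv', hmod]
          _ = p'.1 := e2
      have h2 : p.2 = p'.2 := by
        have hq : (q₁ : ℤ) ≠ 0 := by exact_mod_cast hq₁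
        have e : (p.2 : ℤ) * q₁ = (p'.2 : ℤ) * q₁ := by
          have := hp.2.2; have := hp'.2.2
          have h1' : (p.1 : ℤ) = p'.1 := by exact_mod_cast h1
          linear_combination hp'.2.2 - hp.2.2 + (q₂ : ℤ) * h1'
        exact_mod_cast mul_right_cancel₀ hq e
      exact Prod.ext h1 h2
  rw [Finset.card_range] at hcard
  have hreal : ((H / a : ℕ) : ℝ) ≤ (H : ℝ) / a := Nat.cast_div_le
  have hqa' : (q₁ : ℝ) = a * g := by exact_mod_cast hqa
  have ha0' : (0 : ℝ) < a := by exact_mod_cast ha0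
  have hg0' : (0 : ℝ) < g := by exact_mod_cast hg0
  calc (#(linePairs q₁ q₂ H l) : ℝ) ≤ ((H / a + 1 : ℕ) : ℝ) := by exact_mod_cast hcard
    _ = ((H / a : ℕ) : ℝ) + 1 := by push_cast; ring
    _ ≤ (H : ℝ) / a + 1 := by linarith
    _ = (H : ℝ) * (g : ℕ) / q₁ + 1 := by
        rw [hqa']; field_simp

/-- `linePairs` for `(q₂, q₁, −l)` is the coordinate swap of `linePairs` for `(q₁, q₂, l)`. [folklore] -/
theorem card_linePairs_swap (q₁ q₂ H : ℕ) (l : ℤ) :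
    #(linePairs q₂ q₁ H (-l)) = #(linePairs q₁ q₂ H l) := by
  refine Finset.card_bij (fun p _ => p.swap) ?_ ?_ ?_
  · intro p hp
    rw [mem_linePairs] at hp ⊢
    refine ⟨hp.2.1, hp.1, ?_⟩
    simp only [Prod.fst_swap, Prod.snd_swap]
    linear_combination -hp.2.2
  · intro p _ p' _ h
    exact Prod.swap_injective h
  · intro p hp
    refine ⟨p.swap, ?_, Prod.swap_swap p⟩
    rw [mem_linePairs] at hp ⊢
    refine ⟨hp.2.1, hp.1, ?_⟩
    simp only [Prod.fst_swap, Prod.snd_swap]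
    linear_combination -hp.2.2

/-- **`ν(l; q₁, q₂) ≤ H (q₁,q₂)/max(q₁,q₂) + 1`** for `q₁, q₂ ≥ 1`.
[cite: BombieriFriedlanderIwaniecActa1986, §8 p. 227] -/
theorem card_linePairs_le {q₁ q₂ H : ℕ} (hq₁ : q₁ ≠ 0) (hq₂ : q₂ ≠ 0) (l : ℤ) :
    (#(linePairs q₁ q₂ H l) : ℝ) ≤
      (H : ℝ) * (Nat.gcd q₁ q₂ : ℕ) / ((max q₁ q₂ : ℕ) : ℝ) + 1 := by
  rcases le_total q₂ q₁ with h | h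
  · rw [max_eq_left h]; exact card_linePairs_le_left hq₁ l
  · rw [max_eq_right h, ← card_linePairs_swap, Nat.gcd_comm]
    exact card_linePairs_le_left hq₂ (-l)

/-! ### The diagonal `h₁ q₂ = h₂ q₁` -/

/-- The pairs `1 ≤ h₁, h₂ ≤ H` with `h₁ q₂ = h₂ q₁` (the diagonal `n = 0` of BFI p. 227).
[cite: BombieriFriedlanderIwaniecActa1986, §8 p. 227] -/
def diagPairs (q₁ q₂ H : ℕ) : Finset (ℕ × ℕ) :=
  (Icc 1 H ×ˢ Icc 1 H).filter (fun p => p.1 * q₂ = p.2 * q₁)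

/-- Membership in `diagPairs`. [folklore] -/
theorem mem_diagPairs {q₁ q₂ H : ℕ} {p : ℕ × ℕ} :
    p ∈ diagPairs q₁ q₂ H ↔ (1 ≤ p.1 ∧ p.1 ≤ H) ∧ (1 ≤ p.2 ∧ p.2 ≤ H) ∧ p.1 * q₂ = p.2 * q₁ := by
  simp only [diagPairs, Finset.mem_filter, Finset.mem_product, Finset.mem_Icc, and_assoc]

/-- **`ν(0; q₁, q₂) ≤ H (q₁,q₂)/q₁`**: `h₁` is a positive multiple of `q₁/(q₁,q₂)` and determines
`h₂`. [folklore] -/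
theorem card_diagPairs_le_left {q₁ q₂ H : ℕ} (hq₁ : q₁ ≠ 0) :
    (#(diagPairs q₁ q₂ H) : ℝ) ≤ (H : ℝ) * (Nat.gcd q₁ q₂ : ℕ) / q₁ := by
  set g := Nat.gcd q₁ q₂ with hg
  have hg0 : 0 < g := Nat.gcd_pos_of_pos_left _ (Nat.pos_of_ne_zero hq₁)
  set a := q₁ / g with ha
  set b := q₂ / g with hb
  have hqa : q₁ = a * g := (Nat.div_mul_cancel (Nat.gcd_dvd_left q₁ q₂)).symm
  have hqb : q₂ = b * g := (Nat.div_mul_cancel (Nat.gcd_dvd_right q₁ q₂)).symm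
  have hcop : Nat.Coprime a b := Nat.coprime_div_gcd_div_gcd hg0
  have ha0 : 0 < a := by
    rcases Nat.eq_zero_or_pos a with h | h
    · rw [h, zero_mul] at hqa; exact absurd hqa hq₁
    · exact h
  -- injection `p ↦ p.1` into the multiples of `a` in `[1, H]`
  have hcard : #(diagPairs q₁ q₂ H) ≤ #((Ioc 0 H).filter (fun h => a ∣ h)) := by
    refine Finset.card_le_card_of_injOn (fun p => p.1) ?_ ?_
    · intro p hp
      rw [Finset.mem_coe, mem_diagPairs] at hp
      rw [Finset.mem_coe, Finset.mem_filter, Finset.mem_Ioc]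
      refine ⟨⟨hp.1.1, hp.1.2⟩, ?_⟩
      -- `p.1 b = p.2 a`, so `a ∣ p.1 b`, so `a ∣ p.1`
      have e : p.1 * b = p.2 * a := by
        have := hp.2.2
        rw [hqa, hqb, ← mul_assoc, ← mul_assoc] at this
        exact Nat.eq_of_mul_eq_mul_right hg0 this
      exact hcop.dvd_of_dvd_mul_right ⟨p.2, by rw [e, mul_comm]⟩
    · intro p hp p' hp' h1
      rw [Finset.mem_coe, mem_diagPairs] at hp hp'
      have h1' : p.1 = p'.1 := h1
      have h2 : p.2 = p'.2 := by
        have e : p.2 * q₁ = p'.2 * q₁ := by rw [← hp.2.2, ← hp'.2.2, h1']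
        exact Nat.eq_of_mul_eq_mul_right (Nat.pos_of_ne_zero hq₁) e
      exact Prod.ext h1' h2
  rw [Nat.Ioc_filter_dvd_card_eq_div] at hcard
  have hreal : ((H / a : ℕ) : ℝ) ≤ (H : ℝ) / a := Nat.cast_div_le
  have hqa' : (q₁ : ℝ) = a * g := by exact_mod_cast hqa
  have ha0' : (0 : ℝ) < a := by exact_mod_cast ha0
  have hg0' : (0 : ℝ) < g := by exact_mod_cast hg0
  calc (#(diagPairs q₁ q₂ H) : ℝ) ≤ ((H / a : ℕ) : ℝ) := by exact_mod_cast hcard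
    _ ≤ (H : ℝ) / a := hreal
    _ = (H : ℝ) * (g : ℕ) / q₁ := by rw [hqa']; field_simp

/-- `diagPairs` for `(q₂, q₁)` is the coordinate swap of `diagPairs` for `(q₁, q₂)`. [folklore] -/
theorem card_diagPairs_swap (q₁ q₂ H : ℕ) : #(diagPairs q₂ q₁ H) = #(diagPairs q₁ q₂ H) := by
  refine Finset.card_bij (fun p _ => p.swap) ?_ ?_ ?_
  · intro p hp
    rw [mem_diagPairs] at hp ⊢
    exact ⟨hp.2.1, hp.1, by simp only [Prod.fst_swap, Prod.snd_swap]; exact hp.2.2.symm⟩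
  · intro p _ p' _ h
    exact Prod.swap_injective h
  · intro p hp
    refine ⟨p.swap, ?_, Prod.swap_swap p⟩
    rw [mem_diagPairs] at hp ⊢
    exact ⟨hp.2.1, hp.1, by simp only [Prod.fst_swap, Prod.snd_swap]; exact hp.2.2.symm⟩

/-- **`ν(0; q₁, q₂) ≤ H (q₁,q₂)/max(q₁,q₂)`** for `q₁, q₂ ≥ 1`.
[cite: BombieriFriedlanderIwaniecActa1986, §8 p. 227] -/
theorem card_diagPairs_le {q₁ q₂ H : ℕ} (hq₁ : q₁ ≠ 0) (hq₂ : q₂ ≠ 0) :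
    (#(diagPairs q₁ q₂ H) : ℝ) ≤ (H : ℝ) * (Nat.gcd q₁ q₂ : ℕ) / ((max q₁ q₂ : ℕ) : ℝ) := by
  rcases le_total q₂ q₁ with h | h
  · rw [max_eq_left h]; exact card_diagPairs_le_left hq₁
  · rw [max_eq_right h, ← card_diagPairs_swap, Nat.gcd_comm]
    exact card_diagPairs_le_left hq₂

/-- **The diagonal count** (BFI p. 227, "the terms on the diagonal"):
`∑_{q₁,q₂ ≤ Q} ♯{h₁,h₂ ≤ H : h₁q₂ = h₂q₁} ≤ 2H ∑_{q ≤ Q} τ(q)`.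
[cite: BombieriFriedlanderIwaniecActa1986, §8 p. 227] -/
theorem sum_card_diagPairs_le (Q H : ℕ) :
    ∑ q₁ ∈ Icc 1 Q, ∑ q₂ ∈ Icc 1 Q, (#(diagPairs q₁ q₂ H) : ℝ) ≤
      2 * H * ∑ q ∈ Icc 1 Q, ((#q.divisors : ℕ) : ℝ) := by
  calc ∑ q₁ ∈ Icc 1 Q, ∑ q₂ ∈ Icc 1 Q, (#(diagPairs q₁ q₂ H) : ℝ)
      ≤ ∑ q₁ ∈ Icc 1 Q, ∑ q₂ ∈ Icc 1 Q,
          (H : ℝ) * (((Nat.gcd q₁ q₂ : ℕ) : ℝ) / ((max q₁ q₂ : ℕ) : ℝ)) := by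
        refine Finset.sum_le_sum fun q₁ hq₁ => Finset.sum_le_sum fun q₂ hq₂ => ?_
        have h1 : q₁ ≠ 0 := by have := (Finset.mem_Icc.1 hq₁).1; omega
        have h2 : q₂ ≠ 0 := by have := (Finset.mem_Icc.1 hq₂).1; omega
        rw [← mul_div_assoc]
        exact card_diagPairs_le h1 h2
    _ = (H : ℝ) * ∑ q₁ ∈ Icc 1 Q, ∑ q₂ ∈ Icc 1 Q,
          ((Nat.gcd q₁ q₂ : ℕ) : ℝ) / ((max q₁ q₂ : ℕ) : ℝ) := by
        rw [Finset.mul_sum]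
        refine Finset.sum_congr rfl fun q₁ _ => ?_
        rw [Finset.mul_sum]
    _ ≤ (H : ℝ) * (2 * ∑ q ∈ Icc 1 Q, ((#q.divisors : ℕ) : ℝ)) :=
        mul_le_mul_of_nonneg_left (sum_sum_gcd_div_max_le Q) (Nat.cast_nonneg _)
    _ = 2 * H * ∑ q ∈ Icc 1 Q, ((#q.divisors : ℕ) : ℝ) := by ring

/-- **The off-diagonal count** in summed form (BFI p. 227, the bound for `‖B‖²`):
`∑_{q₁,q₂ ≤ Q} (H(q₁,q₂)/max(q₁,q₂) + 1) ≤ Q² + 2H ∑_{q≤Q} τ(q)`.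
[cite: BombieriFriedlanderIwaniecActa1986, §8 p. 227] -/
theorem sum_linePairs_bound_le (Q H : ℕ) :
    ∑ q₁ ∈ Icc 1 Q, ∑ q₂ ∈ Icc 1 Q,
        ((H : ℝ) * (Nat.gcd q₁ q₂ : ℕ) / ((max q₁ q₂ : ℕ) : ℝ) + 1) ≤
      (Q : ℝ) ^ 2 + 2 * H * ∑ q ∈ Icc 1 Q, ((#q.divisors : ℕ) : ℝ) := by
  have hsplit : ∑ q₁ ∈ Icc 1 Q, ∑ q₂ ∈ Icc 1 Q,
      ((H : ℝ) * (Nat.gcd q₁ q₂ : ℕ) / ((max q₁ q₂ : ℕ) : ℝ) + 1) =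
      (H : ℝ) * (∑ q₁ ∈ Icc 1 Q, ∑ q₂ ∈ Icc 1 Q,
        ((Nat.gcd q₁ q₂ : ℕ) : ℝ) / ((max q₁ q₂ : ℕ) : ℝ)) + (Q : ℝ) ^ 2 := by
    simp only [Finset.sum_add_distrib, Finset.sum_const, Nat.card_Icc, add_tsub_cancel_right,
      Finset.mul_sum, mul_div_assoc]
    ring
  rw [hsplit]
  have h := mul_le_mul_of_nonneg_left (sum_sum_gcd_div_max_le Q) (Nat.cast_nonneg H)
  nlinarith [h]

end BFI

end Literature.NumberTheory.Sieve
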